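import Literature.Analysis.FluidPDE.LerayHopfFinalWeakSliceTools
import HarnessLib

/-!
# Leray–Hopf on every `[0, T')`, `T' < T` ⇒ Leray–Hopf on `[0, T]` with the weak final slice

Analysis/FluidPDE proofs file (theorems only: no definition, no named fact). Let `u` be a
Leray–Hopf weak solution of the unforced Navier–Stokes system on every slab `[0, T')`,
`0 < T' < T` (`IsLerayHopfOn T' ν 0 u₀ u`), `ν > 0`, on a finite-dimensional inner product
space `E` (`ℝ³`). Then:

* `exists_tendsto_integral_inner_nhdsLT_of_forall_lt` — **the slices `u(t)` converge weakly in
  `L²` as `t → T⁻`** to some `Y ∈ L²(E; E)`: `∫⟪u(t), w⟫ → ∫⟪Y, w⟫` for every `w ∈ L²`.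
  Proof: `u` is a weak solution on `[0, T)` in `L^∞(0, T; L²)` (tools file), so for a
  divergence-free test field `φ` the pairing `∫⟪u(t), φ⟫` agrees for a.e. `t` with the
  continuous function `⟨u₀, φ⟩ + ∫_{(0,t]} ∫(⟪u,(u·∇)φ⟫ + ν⟪u,Δφ⟫)`
  (`IsWeakNSSolutionOn.ae_inner_test_eq`, Galdi 2000, Lemma 2.1), hence — both being continuous
  on `(0, T)` — everywhere on `(0, T)`, and has a limit at `T⁻`; against a test gradient the
  pairing vanishes on `(0, T)` (a.e. by the divergence constraint, everywhere by continuity);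
  these generators span a dense subspace of `L²(E; E)` (`dense_span_solenoidalOrGradient`, the
  density half of the Helmholtz–Weyl decomposition), and the slices are bounded in `L²` by the
  energy inequality, so the weak limit exists by the `ε/3` argument and Riesz' theorem
  (`exists_forall_tendsto_inner_of_dense_span`).
* `exists_isLerayHopfOn_update_of_forall_lt` — **redefining `u(T) := Y` gives a Leray–Hopf
  solution on `[0, T]`**: the weak formulation, the energy bound and the energy inequalities
  for `t < T` come from the tools file (patched weak gradient); at `t = T` the energy
  inequalities follow by weak lower semicontinuity of the energy and continuity from below of
  the dissipation (`kineticEnergy_add_dissipation_le_of_tendsto`); weak continuity at `T` is the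
  construction of `Y`, inside `(0, T)` and at `0⁺` it is that of the slabs.

This is the form in which a classical solution on its maximal interval `[0, T)`, Leray–Hopf on
every closed sub-slab, is seen to be a Leray–Hopf weak solution up to and including the blow-up
time (Leray 1934, §31–§33: a regular solution that becomes irregular at `T` is continued as a
turbulent solution, whose slice at `T` is the weak limit; Galdi 2000, Def. 2.1, Lemma 2.2).

## References

* J. Leray, *Sur le mouvement d'un liquide visqueux emplissant l'espace*, Acta Math. 63 (1934),
  §III, §§31–33. [Leray1934]
* G. P. Galdi, *An introduction to the Navier–Stokes initial-boundary value problem* (2000),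
  Def. 2.1, Lemma 2.1, Lemma 2.2. [Galdi2000]
-/

noncomputable section

open MeasureTheory TopologicalSpace Set Function Filter
open _root_.Topology
open scoped InnerProductSpace RealInnerProductSpace ENNReal NNReal Laplacian

namespace Literature.Analysis.FluidPDE

variable {E : Type*} [NormedAddCommGroup E] [InnerProductSpace ℝ E] [FiniteDimensional ℝ E]
  [MeasurableSpace E] [BorelSpace E]
variable {T ν : ℝ} {u : ℝ → E → E} {u₀ : E → E}

/-- The `L²` pairing of a class `Y` with the class of an `L²` field `g` is `∫ ⟪Y, g⟫`. [folklore] -/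
theorem inner_toLp_right_eq_integral_inner (Y : Lp E 2 (volume : Measure E)) {g : E → E}
    (hg : MemLp g 2 (volume : Measure E)) :
    ⟪Y, hg.toLp g⟫ = ∫ x, ⟪(Y : E → E) x, g x⟫ := by
  rw [L2.inner_def]
  refine integral_congr_ae ?_
  filter_upwards [hg.coeFn_toLp] with x hx
  rw [hx]

/-- **The weak `L²` limit of the slices at the final time.** For a Leray–Hopf solution on every
`[0, T')`, `0 < T' < T` (no force, `ν ≥ 0`), there is `Y ∈ L²(E; E)` with
`∫⟪u(t), w⟫ → ∫⟪Y, w⟫` as `t → T⁻` for every `w ∈ L²` (module docstring for the proof;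
Leray 1934, §31; Galdi 2000, Lemma 2.1–2.2; the density of `C_{c,σ}^∞ ⊕ ∇C_c^∞` in `L²` is
Temam 1977, Ch. I, Thm. 1.4). [cite: Galdi2000, Lemma 2.2] -/
theorem exists_tendsto_integral_inner_nhdsLT_of_forall_lt (hT : 0 < T) (hν : 0 ≤ ν)
    (h : ∀ T' ∈ Ioo 0 T, IsLerayHopfOn T' ν 0 u₀ u) :
    ∃ Y : E → E, MemLp Y 2 volume ∧ ∀ w : E → E, MemLp w 2 volume →
      Tendsto (fun t => ∫ x, ⟪u t x, w x⟫) (𝓝[<] T) (𝓝 (∫ x, ⟪Y x, w x⟫)) := by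
  classical
  have hW : IsWeakNSSolutionOn T ν 0 u₀ u := isWeakNSSolutionOn_of_forall_lt hT hν h
  have hE : MemLqLp ∞ 2 u (Ioo 0 T) := memLqLp_of_forall_lt hν h
  -- the `L²` classes of the slices, bounded by `M`
  set M : ℝ := Real.sqrt (2 * VectorCalculus.kineticEnergy u₀) with hM
  let x : ℝ → Lp E 2 (volume : Measure E) := fun t =>
    if hm : MemLp (u t) 2 volume then hm.toLp (u t) else 0
  have hx : ∀ {t : ℝ} (ht : t ∈ Ico 0 T), x t = (memLp_of_forall_lt h ht).toLp (u t) := fun ht =>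
    dif_pos (memLp_of_forall_lt h ht)
  have hIoo : Ioo 0 T ∈ 𝓝[<] T := Ioo_mem_nhdsLT hT
  have hMev : ∀ᶠ t in 𝓝[<] T, ‖x t‖ ≤ M := by
    filter_upwards [hIoo] with t ht
    rw [hx (Ioo_subset_Ico_self ht)]
    exact norm_toLp_le_of_forall_lt hν h (Ioo_subset_Ico_self ht)
  -- convergence of the pairings against the generators
  have hconv : ∀ d ∈ solenoidalOrGradient E,
      ∃ L : ℝ, Tendsto (fun t => ⟪x t, d⟫) (𝓝[<] T) (𝓝 L) := by
    rintro d (⟨φ, hφ, hφdiv, hdφ⟩ | ⟨q, hq, hdq⟩)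
    · -- a divergence-free test field: continuous model of the pairing on `[0, T]`
      have hFint : IntegrableOn
          (fun s => ∫ y, (⟪u s y, convect (u s) φ y⟫ + ν * ⟪u s y, (Δ φ) y⟫)) (Icc 0 T) :=
        (integrableOn_Icc_iff_integrableOn_Ioo (by simp) (by simp)).2
          (hW.integrableOn_flux_of_memLqLp hE hφ)
      have hg_cont : ContinuousOn (fun t => (∫ y, ⟪u₀ y, φ y⟫) + ∫ s in Ioc 0 t,
          ∫ y, (⟪u s y, convect (u s) φ y⟫ + ν * ⟪u s y, (Δ φ) y⟫)) (Icc 0 T) :=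
        continuousOn_const.add (intervalIntegral.continuousOn_primitive hFint)
      have hP_cont : ContinuousOn (fun t => ∫ y, ⟪u t y, φ y⟫) (Ioo 0 T) :=
        continuousOn_integral_inner_of_forall_lt h (hφ.memLp_volume 2)
      have heq := Measure.eqOn_open_of_ae_eq (hW.ae_inner_test_eq hE hφ hφdiv) isOpen_Ioo hP_cont
        (hg_cont.mono Ioo_subset_Icc_self)
      refine ⟨(∫ y, ⟪u₀ y, φ y⟫) + ∫ s in Ioc 0 T,
        ∫ y, (⟪u s y, convect (u s) φ y⟫ + ν * ⟪u s y, (Δ φ) y⟫), ?_⟩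
      have hgT := (hg_cont T (right_mem_Icc.2 hT.le)).tendsto
      have hle : 𝓝[<] T ≤ 𝓝[Icc 0 T] T := by
        rw [← nhdsWithin_Ioo_eq_nhdsLT hT]
        exact nhdsWithin_mono _ Ioo_subset_Icc_self
      refine (hgT.mono_left hle).congr' ?_
      filter_upwards [hIoo] with t ht
      have h1 : ∫ y, ⟪u t y, φ y⟫ = (∫ y, ⟪u₀ y, φ y⟫) + ∫ s in Ioc 0 t,
          ∫ y, (⟪u s y, convect (u s) φ y⟫ + ν * ⟪u s y, (Δ φ) y⟫) := heq ht
      rw [← h1, hx (Ioo_subset_Ico_self ht), inner_toLp_eq_integral]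
      exact integral_congr_ae (hdφ.mono fun y hy => by simp only [hy])
    · -- a test gradient: the pairing vanishes on `(0, T)`
      refine ⟨0, tendsto_const_nhds.congr' ?_⟩
      have hP_cont : ContinuousOn (fun t => ∫ y, ⟪u t y, gradient q y⟫) (Ioo 0 T) :=
        continuousOn_integral_inner_of_forall_lt h (hq.memLp_gradient 2)
      have hae : ∀ᵐ t ∂(volume.restrict (Ioo 0 T)),
          (fun t => ∫ y, ⟪u t y, gradient q y⟫) t = (fun _ => (0 : ℝ)) t :=
        hW.2.2.1.mono fun t ht => ht q hq
      have heq := Measure.eqOn_open_of_ae_eq hae isOpen_Ioo hP_cont continuousOn_const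
      filter_upwards [hIoo] with t ht
      rw [hx (Ioo_subset_Ico_self ht), inner_toLp_eq_integral,
        integral_congr_ae (hdq.mono fun y hy =>
          show ⟪u t y, (d : E → E) y⟫ = ⟪u t y, gradient q y⟫ by rw [hy])]
      exact (heq ht).symm
  obtain ⟨Y, -, hYlim⟩ :=
    exists_forall_tendsto_inner_of_dense_span hMev dense_span_solenoidalOrGradient hconv
  refine ⟨Y, Lp.memLp Y, fun w hw => ?_⟩
  have h1 := hYlim (hw.toLp w)
  rw [inner_toLp_right_eq_integral_inner] at h1
  refine h1.congr' ?_
  filter_upwards [hIoo] with t ht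
  rw [hx (Ioo_subset_Ico_self ht), inner_toLp_toLp_eq_integral]

/-- **Leray–Hopf up to the final time.** If `u` is a Leray–Hopf weak solution of the unforced
Navier–Stokes system on every `[0, T')`, `0 < T' < T`, with `ν > 0`, then redefining the slice at
`T` as the weak `L²` limit `Y` of `u(t)`, `t → T⁻`, gives a Leray–Hopf weak solution
`Function.update u T Y` on `[0, T]` (same datum, same viscosity): the weak formulation is that of
`u` on `[0, T)` (it sees the slices only a.e. in time), every slice is in `L²`, the patched weak
gradient has finite dissipation on `(0, T)`, the energy inequalities from `0` and from a.e. `s`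
hold for `t < T` by the slabs and at `t = T` by weak lower semicontinuity of the energy and
continuity from below of the dissipation, weak `L²` continuity holds at `T` by construction and
on `(0, T)`, at `0⁺` (with the strong attainment of the datum) by the slabs (Leray 1934,
§31–§33; Galdi 2000, Def. 2.1 and Lemma 2.2). [cite: Galdi2000, Lemma 2.2] -/
theorem exists_isLerayHopfOn_update_of_forall_lt (hT : 0 < T) (hν : 0 < ν)
    (h : ∀ T' ∈ Ioo 0 T, IsLerayHopfOn T' ν 0 u₀ u) :
    ∃ Y : E → E, MemLp Y 2 volume ∧ IsLerayHopfOn T ν 0 u₀ (Function.update u T Y) := by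
  classical
  obtain ⟨Y, hY, hYlim⟩ := exists_tendsto_integral_inner_nhdsLT_of_forall_lt hT hν.le h
  obtain ⟨G, hG, hGfin, hG0, hGs⟩ := exists_hasWeakGradient_of_forall_lt hT hν h
  have hvT : Function.update u T Y T = Y := Function.update_self T Y u
  have hv_lt : ∀ {t : ℝ}, t < T → Function.update u T Y t = u t := fun ht =>
    Function.update_of_ne ht.ne Y u
  have hae : ∀ᵐ t ∂(volume.restrict (Ioo 0 T)), Function.update u T Y t = u t :=
    (ae_restrict_mem measurableSet_Ioo).mono fun t ht => hv_lt ht.2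
  have hT2 : T / 2 ∈ Ioo 0 T := ⟨by linarith, by linarith⟩
  -- the energy inequality at `t = T` from `s ∈ [0, T)`, by the limit step
  have hlimit : ∀ {s R : ℝ}, 0 ≤ s → s < T →
      (∀ t ∈ Ioo s T, VectorCalculus.kineticEnergy (u t) +
        ν * (∫⁻ τ in Ioo s t, ∫⁻ x, ENNReal.ofReal (frobeniusNormSq (G τ x))).toReal ≤ R) →
      VectorCalculus.kineticEnergy Y +
        ν * (∫⁻ τ in Ioo s T, ∫⁻ x, ENNReal.ofReal (frobeniusNormSq (G τ x))).toReal ≤ R := by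
    intro s R hs hsT hineq
    refine kineticEnergy_add_dissipation_le_of_tendsto hsT hY
      (fun t ht => memLp_of_forall_lt h ⟨hs.trans ht.1.le, ht.2⟩) (hYlim Y hY) ?_ hineq
    exact (lt_of_le_of_lt (lintegral_mono_set (Ioo_subset_Ioo_left hs)) hGfin).ne
  refine ⟨Y, hY, (isWeakNSSolutionOn_of_forall_lt hT hν.le h).congr_ae_slice hae,
    ⟨(2 * VectorCalculus.kineticEnergy u₀).toNNReal, ?_⟩, fun t ht => ?_,
    ⟨G, ?_, hGfin, fun t ht => ?_, ?_⟩, fun w hw => ⟨fun t ht => ?_, ?_⟩, ?_⟩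
  · -- energy bound on `(0, T)`
    filter_upwards [ae_restrict_mem measurableSet_Ioo] with t ht
    rw [hv_lt ht.2]
    exact eEnergy_le_of_forall_lt hν.le h (Ioo_subset_Ico_self ht)
  · -- every slice in `L²`
    rcases eq_or_lt_of_le ht.2 with rfl | hlt
    · rw [hvT]; exact hY
    · rw [hv_lt hlt]; exact memLp_of_forall_lt h ⟨ht.1, hlt⟩
  · -- the patched weak gradient
    filter_upwards [hG, hae] with t ht hvt
    rw [hvt]; exact ht
  · -- energy inequality from `0`
    simp only [Pi.zero_apply, inner_zero_left, integral_zero, intervalIntegral.integral_zero,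
      add_zero]
    rcases eq_or_lt_of_le ht.2 with rfl | hlt
    · rw [hvT]
      exact hlimit le_rfl hT fun s hs => hG0 s ⟨hs.1.le, hs.2⟩
    · rw [hv_lt hlt]
      exact hG0 t ⟨ht.1, hlt⟩
  · -- energy inequality from a.e. `s`
    filter_upwards [hGs, ae_restrict_mem measurableSet_Ioo] with s hs hsT t ht
    simp only [Pi.zero_apply, inner_zero_left, integral_zero, intervalIntegral.integral_zero,
      add_zero]
    rw [hv_lt hsT.2]
    rcases eq_or_lt_of_le ht.2 with rfl | hlt
    · rw [hvT]
      exact hlimit hsT.1.le hsT.2 fun t' ht' => hs t' ⟨ht'.1.le, ht'.2⟩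
    · rw [hv_lt hlt]
      exact hs t ⟨ht.1, hlt⟩
  · -- weak continuity on `(0, T]`
    rcases eq_or_lt_of_le ht.2 with rfl | hlt
    · rw [continuousWithinAt_Ioc_iff_Iic ht.1, ← continuousWithinAt_Iio_iff_Iic]
      show Tendsto (fun s => ∫ x, ⟪Function.update u t Y s x, w x⟫) (𝓝[<] t)
        (𝓝 (∫ x, ⟪Function.update u t Y t x, w x⟫))
      rw [hvT]
      refine (hYlim w hw).congr' ?_
      filter_upwards [self_mem_nhdsWithin] with s hs
      rw [hv_lt hs]
    · have hc := (continuousOn_integral_inner_of_forall_lt h hw).continuousAt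
        (isOpen_Ioo.mem_nhds ⟨ht.1, hlt⟩)
      refine (hc.congr ?_).continuousWithinAt
      filter_upwards [Iio_mem_nhds hlt] with s hs
      rw [hv_lt hs]
  · -- weak limit `u₀` at `0⁺`
    refine ((h _ hT2).weak_continuous w hw).2.congr' ?_
    filter_upwards [Ioo_mem_nhdsGT hT] with t ht
    rw [hv_lt ht.2]
  · -- strong attainment of the datum
    refine (h _ hT2).strong_initial.congr' ?_
    filter_upwards [Ioo_mem_nhdsGT hT] with t ht
    rw [hv_lt ht.2]

end Literature.Analysis.FluidPDE
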